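import Literature.Barriers.Parity.SiegelZeroDichotomyPairHLProp81Assembly
import Literature.Barriers.Parity.SiegelZeroDichotomyPairHLProp81Params
import HarnessLib

/-!
# Tao–Teräväinen 2022, §8 (`k = 2`): sizes of the error terms of the assembly

Topic `Literature/Barriers/Parity`, sub-namespace `TaoTeravainen`; bookkeeping for the final assembly of
`Literature.Barriers.Parity.TaoTeravainen2021_prop72_81_pair` (T. Tao, J. Teräväinen, *The
Hardy–Littlewood–Chowla conjecture in the presence of a Siegel zero*, J. London Math. Soc. (2) 106 (2022),
arXiv:2109.06291), §8. With the parameter choices of `…Prop81Params.lean` (`X = log x`,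
`U₀ = ε₀X/20 + 2 log q`, `τ₀ = X^{-9/10}`, `n = 30`) the explicit error terms of
`abs_sharpCorr_sub_le_of_kernelBounds` are polynomial in `X` times a saving; this file PROVES the
elementary size bounds:

* `moebiusSlotErr_le_rpow` — the Möbius-slot error is `≤ C_ε X^{-7/10}` (`C_ε` explicit in
  `ε₀, C₀, S₀, S₃₀`);
* `slotI_le`, `slotJ_le`, `prod_slotI_le`, `tailSum_le`, `kernelEps_le` — the kernel error level is
  `≤ C (A₃ + (A₂ + |𝔖'|A₄)(1 + ε₀T'/(40π))^{-nd} + A₁X²(1 + ε₀T/(40π))^{-nd})`.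
  [cite: TaoTeravainen2021, §8 (8.25) and Lemma 8.2 (8.14)–(8.15)]
-/

noncomputable section

open Finset Real

namespace Literature.Barriers.Parity

namespace TaoTeravainen

/-! ### The Möbius-slot error with `τ₀ = X^{-9/10}`, `n = 30` -/

/-- The constant `C_ε = 2·6e·(1/3)·2·S₀·2C₀(1+2π)² + 7·3·2^{30}·6e·31·2·S₃₀·π·(20/ε₀)^{27}` of
`moebiusSlotErr_le_rpow`. [folklore] -/
def moebiusErrConst (M : ℕ → ℝ) (C₀ ε₀ : ℝ) : ℝ :=
  2 * (6 * Real.exp 1 * (1 / 3) * (2 * cutoffDerivSum M 0)) * (2 * C₀ * (1 + 2 * π) ^ 2) +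
    7 * 3 * (2 ^ 30 * (6 * Real.exp 1) * (31 * 2 * cutoffDerivSum M 30)) * π * (20 / ε₀) ^ 27

/-- **The Möbius-slot error is `≪ X^{-7/10}`**: for `X ≥ 1`, `ε₀X/20 ≤ U₀ ≤ X/3`, `ε₀ > 0`, `C₀ ≥ 0`, `M ≥ 0`,
`moebiusSlotErr M X U₀ C₀ X^{-9/10} 30 ≤ C_ε X^{-7/10}`. [cite: TaoTeravainen2021, §8 (8.25)] -/
theorem moebiusSlotErr_le_rpow {M : ℕ → ℝ} (hM : ∀ i, 0 ≤ M i) {X U₀ C₀ ε₀ : ℝ} (hX : 1 ≤ X) (hε₀ : 0 < ε₀)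
    (hU₀lo : ε₀ / 20 * X ≤ U₀) (hU₀hi : U₀ ≤ X / 3) (hC₀ : 0 ≤ C₀) :
    moebiusSlotErr M X U₀ C₀ (X ^ (-(9 : ℝ) / 10)) 30 ≤ moebiusErrConst M C₀ ε₀ * X ^ (-(7 : ℝ) / 10) := by
  have hX0 : 0 < X := by linarith
  have hU₀0 : 0 < U₀ := lt_of_lt_of_le (by positivity) hU₀lo
  have hS0 : 0 ≤ cutoffDerivSum M 0 := sum_nonneg fun i _ => hM i
  have hS30 : 0 ≤ cutoffDerivSum M 30 := sum_nonneg fun i _ => hM i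
  -- powers of `X`
  set τ₀ := X ^ (-(9 : ℝ) / 10) with hτ₀
  have hτ₀pos : 0 < τ₀ := Real.rpow_pos_of_pos hX0 _
  have hrpow_le : ∀ a b : ℝ, a ≤ b → X ^ a ≤ X ^ b := fun a b hab => Real.rpow_le_rpow_of_exponent_le hX hab
  have hXinv : X⁻¹ ≤ τ₀ := by
    rw [hτ₀, ← Real.rpow_neg_one]; exact hrpow_le _ _ (by norm_num)
  have hmul : ∀ a b : ℝ, X ^ a * X ^ b = X ^ (a + b) := fun a b => (Real.rpow_add hX0 a b).symm
  -- term 1: `2τ₀·6eU₀(X+2U₀)S₀·2C₀(X⁻¹+2πτ₀)² ≤ const · X^{-7/10}`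
  have hXU : X + 2 * U₀ ≤ 2 * X := by linarith
  have h1 : 2 * τ₀ * (6 * Real.exp 1 * U₀ * ((X + 2 * U₀) * cutoffDerivSum M 0)) * (2 * C₀ * (X⁻¹ + 2 * π * τ₀) ^ 2) ≤
      2 * (6 * Real.exp 1 * (1 / 3) * (2 * cutoffDerivSum M 0)) * (2 * C₀ * (1 + 2 * π) ^ 2) * X ^ (-(7 : ℝ) / 10) := by
    have hsq : (X⁻¹ + 2 * π * τ₀) ^ 2 ≤ (1 + 2 * π) ^ 2 * τ₀ ^ 2 := by
      rw [← mul_pow]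
      refine pow_le_pow_left₀ (by positivity) ?_ 2
      nlinarith [Real.pi_pos]
    have hU : U₀ * (X + 2 * U₀) ≤ (1 / 3) * (2 * X ^ (2 : ℝ)) := by
      rw [Real.rpow_two]; nlinarith
    have hτX : τ₀ * X ^ (2 : ℝ) * τ₀ ^ 2 = X ^ (-(7 : ℝ) / 10) := by
      rw [hτ₀, ← Real.rpow_natCast (X ^ (-(9 : ℝ) / 10)) 2, ← Real.rpow_mul hX0.le, hmul, hmul]
      norm_num
    calc 2 * τ₀ * (6 * Real.exp 1 * U₀ * ((X + 2 * U₀) * cutoffDerivSum M 0)) * (2 * C₀ * (X⁻¹ + 2 * π * τ₀) ^ 2)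
        = 2 * (6 * Real.exp 1 * cutoffDerivSum M 0) * (2 * C₀) * (τ₀ * (U₀ * (X + 2 * U₀)) * (X⁻¹ + 2 * π * τ₀) ^ 2) := by ring
      _ ≤ 2 * (6 * Real.exp 1 * cutoffDerivSum M 0) * (2 * C₀) * (τ₀ * ((1 / 3) * (2 * X ^ (2 : ℝ))) * ((1 + 2 * π) ^ 2 * τ₀ ^ 2)) := by
          gcongr
      _ = 2 * (6 * Real.exp 1 * (1 / 3) * (2 * cutoffDerivSum M 0)) * (2 * C₀ * (1 + 2 * π) ^ 2) * (τ₀ * X ^ (2 : ℝ) * τ₀ ^ 2) := by ring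
      _ = _ := by rw [hτX]
  -- term 2
  have h2 : 7 * (X + 2) * (2 ^ 30 * (6 * Real.exp 1) * U₀ * ((1 + (30 : ℕ)) * (X + 2 * U₀) * cutoffDerivSum M 30)) *
      (1 + U₀ * τ₀) ^ 3 / (1 + U₀ * τ₀) ^ 30 * (π / U₀) ≤
      7 * 3 * (2 ^ 30 * (6 * Real.exp 1) * (31 * 2 * cutoffDerivSum M 30)) * π * (20 / ε₀) ^ 27 * X ^ (-(7 : ℝ) / 10) := by
    have hw : ε₀ / 20 * X ^ ((1 : ℝ) / 10) ≤ 1 + U₀ * τ₀ := by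
      have : U₀ * τ₀ ≥ ε₀ / 20 * X * τ₀ := mul_le_mul_of_nonneg_right hU₀lo hτ₀pos.le
      have hXτ : X * τ₀ = X ^ ((1 : ℝ) / 10) := by
        rw [hτ₀, show X * X ^ (-(9 : ℝ) / 10) = X ^ (1 : ℝ) * X ^ (-(9 : ℝ) / 10) by rw [Real.rpow_one], hmul]; norm_num
      have : 0 ≤ (1 : ℝ) := zero_le_one
      nlinarith
    have hwpos : 0 < 1 + U₀ * τ₀ := by positivity
    have hpow : (1 + U₀ * τ₀) ^ 3 / (1 + U₀ * τ₀) ^ 30 = ((1 + U₀ * τ₀) ^ 27)⁻¹ := by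
      rw [div_eq_iff (by positivity), show (30 : ℕ) = 27 + 3 by norm_num, pow_add]; field_simp
    have hε27 : 0 < (ε₀ / 20 * X ^ ((1 : ℝ) / 10)) ^ 27 := by positivity
    have hinv : ((1 + U₀ * τ₀) ^ 27)⁻¹ ≤ (20 / ε₀) ^ 27 * X ^ (-(27 : ℝ) / 10) := by
      calc ((1 + U₀ * τ₀) ^ 27)⁻¹ ≤ ((ε₀ / 20 * X ^ ((1 : ℝ) / 10)) ^ 27)⁻¹ :=
            inv_anti₀ hε27 (pow_le_pow_left₀ (by positivity) hw 27)
        _ = (20 / ε₀) ^ 27 * X ^ (-(27 : ℝ) / 10) := by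
            rw [mul_pow, mul_inv, ← Real.rpow_natCast (X ^ ((1 : ℝ) / 10)) 27, ← Real.rpow_mul hX0.le, ← Real.rpow_neg hX0.le,
              ← inv_pow, inv_div]
            norm_num
    have hXX : (X + 2) * (X + 2 * U₀) ≤ 3 * (2 * X ^ (2 : ℝ)) := by rw [Real.rpow_two]; nlinarith
    have hU : U₀ * (π / U₀) = π := by field_simp
    calc 7 * (X + 2) * (2 ^ 30 * (6 * Real.exp 1) * U₀ * ((1 + (30 : ℕ)) * (X + 2 * U₀) * cutoffDerivSum M 30)) *
          (1 + U₀ * τ₀) ^ 3 / (1 + U₀ * τ₀) ^ 30 * (π / U₀)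
        = 7 * (2 ^ 30 * (6 * Real.exp 1) * (31 * cutoffDerivSum M 30)) * (U₀ * (π / U₀)) *
            (((X + 2) * (X + 2 * U₀)) * ((1 + U₀ * τ₀) ^ 3 / (1 + U₀ * τ₀) ^ 30)) := by push_cast; ring
      _ ≤ 7 * (2 ^ 30 * (6 * Real.exp 1) * (31 * cutoffDerivSum M 30)) * π *
            ((3 * (2 * X ^ (2 : ℝ))) * ((20 / ε₀) ^ 27 * X ^ (-(27 : ℝ) / 10))) := by
          rw [hU, hpow]
          gcongr
      _ = 7 * 3 * (2 ^ 30 * (6 * Real.exp 1) * (31 * 2 * cutoffDerivSum M 30)) * π * (20 / ε₀) ^ 27 *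
            (X ^ (2 : ℝ) * X ^ (-(27 : ℝ) / 10)) := by ring
      _ = _ := by rw [hmul]; norm_num
  unfold moebiusSlotErr moebiusErrConst
  have h := add_le_add h1 h2
  refine le_trans (le_of_eq ?_) (h.trans (le_of_eq ?_))
  · push_cast; ring
  · ring

/-! ### The kernel error level -/

section KernelEps

variable {M Cs : ℕ → ℝ} {X U₀ ε₀ : ℝ} {κ nd : ℕ}

/-- The `d`-slot coefficient `b_I = (20/ε₀)^κ 2^{κ+2} 6e (κ+3) 2 S_{κ+2} π` (so that `I_d ≤ b_I X`). [folklore] -/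
def dSlotIConst (M : ℕ → ℝ) (ε₀ : ℝ) (κ : ℕ) : ℝ :=
  (20 / ε₀) ^ κ * (2 ^ (κ + 2) * (6 * Real.exp 1) * ((1 + (κ + 2 : ℕ)) * 2 * cutoffDerivSum M (κ + 2))) * π

/-- The `d`-slot tail coefficient `b_J` (so that `J_d(T) ≤ b_J X (1 + ε₀T/(40π))^{-nd}`). [folklore] -/
def dSlotJConst (M : ℕ → ℝ) (ε₀ : ℝ) (κ nd : ℕ) : ℝ :=
  (20 / ε₀) ^ κ * (2 ^ (κ + nd + 2) * (6 * Real.exp 1) * ((1 + (κ + nd + 2 : ℕ)) * 2 * cutoffDerivSum M (κ + nd + 2))) * π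

/-- A product over the six slots of a function depending only on the slot type. [folklore] -/
theorem prod_slot_of_type (a b : ℝ) : ∏ k : Slot, (if k.2 = 0 then a else b) = a ^ 2 * b ^ 4 := by
  have h : ∀ j : Fin 2, ∏ i : Fin 3, (if ((j, i) : Slot).2 = 0 then a else b) = a * b * b := by
    intro j
    rw [Fin.prod_univ_three]
    simp only [Fin.isValue, if_true, show ((1 : Fin 3) = 0) = False by decide, show ((2 : Fin 3) = 0) = False by decide,
      if_false]
  rw [Fintype.prod_prod_type, Fin.prod_univ_two]
  simp only [h]
  ring

/-- The tail sum pattern `∑_k g_k ∏_{k'≠k} f_{k'}` for slot-type functions with `f > 0`. [folklore] -/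
theorem sum_slot_erase_of_type {a b c d : ℝ} (ha : 0 < a) (hb : 0 < b) :
    ∑ k : Slot, (if k.2 = 0 then c else d) * ∏ k' ∈ univ.erase k, (if k'.2 = 0 then a else b) =
      2 * c * a * b ^ 4 + 4 * d * a ^ 2 * b ^ 3 := by
  classical
  have hf0 : ∀ k : Slot, (if k.2 = 0 then a else b) ≠ 0 := fun k => by split_ifs <;> positivity
  have herase : ∀ k : Slot, ∏ k' ∈ univ.erase k, (if k'.2 = 0 then a else b) =
      (a ^ 2 * b ^ 4) / (if k.2 = 0 then a else b) := by
    intro k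
    rw [eq_div_iff (hf0 k), ← prod_slot_of_type a b, prod_erase_mul _ _ (mem_univ k)]
  simp_rw [herase]
  have h : ∀ j : Fin 2, ∑ i : Fin 3, (if ((j, i) : Slot).2 = 0 then c else d) * (a ^ 2 * b ^ 4 / if ((j, i) : Slot).2 = 0 then a else b) =
      c * (a ^ 2 * b ^ 4 / a) + d * (a ^ 2 * b ^ 4 / b) + d * (a ^ 2 * b ^ 4 / b) := by
    intro j
    rw [Fin.sum_univ_three]
    simp only [Fin.isValue, if_true, show ((1 : Fin 3) = 0) = False by decide, show ((2 : Fin 3) = 0) = False by decide,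
      if_false]
  rw [Fintype.sum_prod_type, Fin.sum_univ_two]
  simp only [h]
  field_simp
  ring

/-- **`I_k` bounds**: `I_d ≤ b_I X` and `I_s = C_{κ+2} π` (`X ≥ 1`, `ε₀X/20 ≤ U₀ ≤ X/3`, `ε₀ > 0`, `M ≥ 0`). [folklore] -/
theorem slotI_le (hM : ∀ i, 0 ≤ M i) (hX : 1 ≤ X) (hε₀ : 0 < ε₀) (hU₀lo : ε₀ / 20 * X ≤ U₀) (hU₀hi : U₀ ≤ X / 3)
    (k : Slot) :
    slotI M Cs X U₀ κ k ≤ if k.2 = 0 then dSlotIConst M ε₀ κ * X else Cs (κ + 2) * π := by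
  have hX0 : 0 < X := by linarith
  have hU₀0 : 0 < U₀ := lt_of_lt_of_le (by positivity) hU₀lo
  have hS : 0 ≤ cutoffDerivSum M (κ + 2) := sum_nonneg fun i _ => hM i
  unfold slotI
  split_ifs with hk
  · have hXU : X / U₀ ≤ 20 / ε₀ := by
      rw [div_le_div_iff₀ hU₀0 hε₀]; nlinarith
    have hXU0 : 0 ≤ X / U₀ := by positivity
    unfold psiDecayConst dSlotIConst
    calc (X / U₀) ^ κ * (2 ^ (κ + 2) * (6 * Real.exp 1) * U₀ * ((1 + ((κ + 2 : ℕ) : ℝ)) * (X + 2 * U₀) * cutoffDerivSum M (κ + 2))) * (π / U₀)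
        = (X / U₀) ^ κ * (2 ^ (κ + 2) * (6 * Real.exp 1) * ((1 + ((κ + 2 : ℕ) : ℝ)) * (X + 2 * U₀) * cutoffDerivSum M (κ + 2))) * π *
            (U₀ / U₀) := by ring
      _ ≤ (20 / ε₀) ^ κ * (2 ^ (κ + 2) * (6 * Real.exp 1) * ((1 + ((κ + 2 : ℕ) : ℝ)) * (2 * X) * cutoffDerivSum M (κ + 2))) * π * 1 := by
          rw [div_self hU₀0.ne']
          gcongr
          all_goals first | exact pow_le_pow_left₀ hXU0 hXU κ | linarith
      _ = _ := by ring
  · exact le_rfl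

/-- **`J_k(T)` bounds**: `J_d(T) ≤ b_J X (1+ε₀T/(40π))^{-nd}`, `J_s(T) ≤ C π (1+ε₀T/(40π))^{-nd}` (`T ≥ 0`,
`ε₀ ≤ 20`). [folklore] -/
theorem slotJ_le (hM : ∀ i, 0 ≤ M i) (hCs : ∀ n, 0 ≤ Cs n) (hX : 1 ≤ X) (hε₀ : 0 < ε₀) (hε₀20 : ε₀ ≤ 20)
    (hU₀lo : ε₀ / 20 * X ≤ U₀) (hU₀hi : U₀ ≤ X / 3) {T : ℝ} (hT : 0 ≤ T) (k : Slot) :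
    slotJ M Cs X U₀ κ nd T k ≤
      (if k.2 = 0 then dSlotJConst M ε₀ κ nd * X else Cs (κ + nd + 2) * π) * ((1 + ε₀ * T / (40 * π)) ^ nd)⁻¹ := by
  have hX0 : 0 < X := by linarith
  have hU₀0 : 0 < U₀ := lt_of_lt_of_le (by positivity) hU₀lo
  have hS : 0 ≤ cutoffDerivSum M (κ + nd + 2) := sum_nonneg fun i _ => hM i
  have hθpos : 0 < 1 + ε₀ * T / (40 * π) := by positivity
  unfold slotJ
  split_ifs with hk
  · -- `1 + U₀ T/(2πX) ≥ 1 + ε₀T/(40π)`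
    have hcmp : 1 + ε₀ * T / (40 * π) ≤ 1 + U₀ * (T / (2 * π * X)) := by
      have : ε₀ * T / (40 * π) ≤ U₀ * (T / (2 * π * X)) := by
        rw [show U₀ * (T / (2 * π * X)) = U₀ * T / (2 * π * X) by ring,
          div_le_div_iff₀ (by positivity) (by positivity)]
        have h1 : ε₀ * X * T ≤ 20 * U₀ * T := by nlinarith
        nlinarith [h1, Real.pi_pos]
      linarith
    have hinv : ((1 + U₀ * (T / (2 * π * X))) ^ nd)⁻¹ ≤ ((1 + ε₀ * T / (40 * π)) ^ nd)⁻¹ :=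
      inv_anti₀ (by positivity) (pow_le_pow_left₀ hθpos.le hcmp nd)
    have hXU : X / U₀ ≤ 20 / ε₀ := by rw [div_le_div_iff₀ hU₀0 hε₀]; nlinarith
    have hXU0 : 0 ≤ X / U₀ := by positivity
    unfold psiDecayConst dSlotJConst
    calc (X / U₀) ^ κ * (2 ^ (κ + nd + 2) * (6 * Real.exp 1) * U₀ * ((1 + ((κ + nd + 2 : ℕ) : ℝ)) * (X + 2 * U₀) * cutoffDerivSum M (κ + nd + 2))) *
          ((1 + U₀ * (T / (2 * π * X))) ^ nd)⁻¹ * (π / U₀)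
        = (X / U₀) ^ κ * (2 ^ (κ + nd + 2) * (6 * Real.exp 1) * ((1 + ((κ + nd + 2 : ℕ) : ℝ)) * (X + 2 * U₀) * cutoffDerivSum M (κ + nd + 2))) * π *
            ((1 + U₀ * (T / (2 * π * X))) ^ nd)⁻¹ * (U₀ / U₀) := by ring
      _ ≤ (20 / ε₀) ^ κ * (2 ^ (κ + nd + 2) * (6 * Real.exp 1) * ((1 + ((κ + nd + 2 : ℕ) : ℝ)) * (2 * X) * cutoffDerivSum M (κ + nd + 2))) * π *
            ((1 + ε₀ * T / (40 * π)) ^ nd)⁻¹ * 1 := by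
          rw [div_self hU₀0.ne']
          gcongr
          all_goals first | exact pow_le_pow_left₀ hXU0 hXU κ | linarith
      _ = _ := by ring
  · have hcmp : 1 + ε₀ * T / (40 * π) ≤ 1 + T / (2 * π) := by
      have : ε₀ * T / (40 * π) ≤ T / (2 * π) := by
        rw [div_le_div_iff₀ (by positivity) (by positivity)]
        nlinarith [mul_nonneg (mul_nonneg Real.pi_pos.le hT) (sub_nonneg.mpr hε₀20)]
      linarith
    have hinv : ((1 + T / (2 * π)) ^ nd)⁻¹ ≤ ((1 + ε₀ * T / (40 * π)) ^ nd)⁻¹ :=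
      inv_anti₀ (by positivity) (pow_le_pow_left₀ hθpos.le hcmp nd)
    have := hCs (κ + nd + 2)
    calc Cs (κ + nd + 2) * ((1 + T / (2 * π)) ^ nd)⁻¹ * π = Cs (κ + nd + 2) * π * ((1 + T / (2 * π)) ^ nd)⁻¹ := by ring
      _ ≤ Cs (κ + nd + 2) * π * ((1 + ε₀ * T / (40 * π)) ^ nd)⁻¹ := by gcongr

/-- The product constant `c_P = (b_I + 1)² (C_{κ+2}π + 1)⁴` and the tail constant
`c_T = c_P (2 b_J/(b_I+1) + 4 C_{κ+nd+2}π/(C_{κ+2}π+1))`. [folklore] -/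
def prodIConst (M Cs : ℕ → ℝ) (ε₀ : ℝ) (κ : ℕ) : ℝ := (dSlotIConst M ε₀ κ + 1) ^ 2 * (Cs (κ + 2) * π + 1) ^ 4

/-- See `prodIConst`. [folklore] -/
def tailConst (M Cs : ℕ → ℝ) (ε₀ : ℝ) (κ nd : ℕ) : ℝ :=
  2 * dSlotJConst M ε₀ κ nd * (dSlotIConst M ε₀ κ + 1) * (Cs (κ + 2) * π + 1) ^ 4 +
    4 * (Cs (κ + nd + 2) * π) * (dSlotIConst M ε₀ κ + 1) ^ 2 * (Cs (κ + 2) * π + 1) ^ 3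

/-- **`∏_k I_k ≤ c_P X²`**. [folklore] -/
theorem prod_slotI_le (hM : ∀ i, 0 ≤ M i) (hCs : ∀ n, 0 ≤ Cs n) (hX : 1 ≤ X) (hε₀ : 0 < ε₀)
    (hU₀lo : ε₀ / 20 * X ≤ U₀) (hU₀hi : U₀ ≤ X / 3) :
    ∏ k : Slot, slotI M Cs X U₀ κ k ≤ prodIConst M Cs ε₀ κ * X ^ 2 := by
  have hX0 : 0 < X := by linarith
  have hU₀0 : 0 < U₀ := lt_of_lt_of_le (by positivity) hU₀lo
  have hbI : 0 ≤ dSlotIConst M ε₀ κ := by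
    unfold dSlotIConst; have : 0 ≤ cutoffDerivSum M (κ + 2) := sum_nonneg fun i _ => hM i; positivity
  have hI0 : ∀ k, 0 ≤ slotI M Cs X U₀ κ k := fun k => by
    unfold slotI; split_ifs
    · have := psiDecayConst_nonneg hM hU₀0.le (by linarith : 0 ≤ X + 2 * U₀) (κ + 2); positivity
    · exact mul_nonneg (hCs _) Real.pi_pos.le
  calc ∏ k : Slot, slotI M Cs X U₀ κ k ≤ ∏ k : Slot, (if k.2 = 0 then (dSlotIConst M ε₀ κ + 1) * X else Cs (κ + 2) * π + 1) := by
        refine prod_le_prod (fun k _ => hI0 k) fun k _ => (slotI_le hM hX hε₀ hU₀lo hU₀hi k).trans ?_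
        split_ifs <;> nlinarith
    _ = ((dSlotIConst M ε₀ κ + 1) * X) ^ 2 * (Cs (κ + 2) * π + 1) ^ 4 := prod_slot_of_type _ _
    _ = prodIConst M Cs ε₀ κ * X ^ 2 := by unfold prodIConst; ring

/-- **`Σ(T) ≤ c_T X² (1+ε₀T/(40π))^{-nd}`**. [folklore] -/
theorem tailSum_le (hM : ∀ i, 0 ≤ M i) (hCs : ∀ n, 0 ≤ Cs n) (hX : 1 ≤ X) (hε₀ : 0 < ε₀) (hε₀20 : ε₀ ≤ 20)
    (hU₀lo : ε₀ / 20 * X ≤ U₀) (hU₀hi : U₀ ≤ X / 3) {T : ℝ} (hT : 0 ≤ T) :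
    tailSum M Cs X U₀ κ nd T ≤ tailConst M Cs ε₀ κ nd * X ^ 2 * ((1 + ε₀ * T / (40 * π)) ^ nd)⁻¹ := by
  have hX0 : 0 < X := by linarith
  have hU₀0 : 0 < U₀ := lt_of_lt_of_le (by positivity) hU₀lo
  set θ := ((1 + ε₀ * T / (40 * π)) ^ nd)⁻¹ with hθ
  have hθ0 : 0 ≤ θ := by positivity
  have hbI : 0 ≤ dSlotIConst M ε₀ κ := by
    unfold dSlotIConst; have : 0 ≤ cutoffDerivSum M (κ + 2) := sum_nonneg fun i _ => hM i; positivity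
  have hbJ : 0 ≤ dSlotJConst M ε₀ κ nd := by
    unfold dSlotJConst; have : 0 ≤ cutoffDerivSum M (κ + nd + 2) := sum_nonneg fun i _ => hM i; positivity
  have hI0 : ∀ k, 0 ≤ slotI M Cs X U₀ κ k := fun k => by
    unfold slotI; split_ifs
    · have := psiDecayConst_nonneg hM hU₀0.le (by linarith : 0 ≤ X + 2 * U₀) (κ + 2); positivity
    · exact mul_nonneg (hCs _) Real.pi_pos.le
  have hJ0 : ∀ k, 0 ≤ slotJ M Cs X U₀ κ nd T k := fun k => by
    unfold slotJ; split_ifs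
    · have := psiDecayConst_nonneg hM hU₀0.le (by linarith : 0 ≤ X + 2 * U₀) (κ + nd + 2); positivity
    · have := hCs (κ + nd + 2); positivity
  -- termwise majorants
  set fI : Slot → ℝ := fun k => if k.2 = 0 then (dSlotIConst M ε₀ κ + 1) * X else Cs (κ + 2) * π + 1 with hfI
  set fJ : Slot → ℝ := fun k => if k.2 = 0 then dSlotJConst M ε₀ κ nd * X else Cs (κ + nd + 2) * π with hfJ
  have hIle : ∀ k, slotI M Cs X U₀ κ k ≤ fI k := fun k => (slotI_le hM hX hε₀ hU₀lo hU₀hi k).trans (by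
    simp only [hfI]; split_ifs <;> nlinarith)
  have hJle : ∀ k, slotJ M Cs X U₀ κ nd T k ≤ fJ k * θ := fun k => by
    have h := slotJ_le hM hCs hX hε₀ hε₀20 hU₀lo hU₀hi hT k (κ := κ) (nd := nd)
    simp only [hfJ, hθ]; exact h
  have hfI0 : ∀ k, 0 ≤ fI k := fun k => (hI0 k).trans (hIle k)
  unfold tailSum
  calc ∑ k : Slot, slotJ M Cs X U₀ κ nd T k * ∏ k' ∈ univ.erase k, slotI M Cs X U₀ κ k'
      ≤ ∑ k : Slot, (fJ k * θ) * ∏ k' ∈ univ.erase k, fI k' := by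
        refine sum_le_sum fun k _ => mul_le_mul (hJle k) (prod_le_prod (fun k' _ => hI0 k') fun k' _ => hIle k') ?_ ?_
        · exact prod_nonneg fun k' _ => hI0 k'
        · exact mul_nonneg ((hJ0 k).trans (hJle k) |> le_trans (le_refl _)) hθ0 |> fun h => by
            have := hJ0 k; have := hJle k; nlinarith
    _ = θ * ∑ k : Slot, fJ k * ∏ k' ∈ univ.erase k, fI k' := by rw [mul_sum]; refine sum_congr rfl fun k _ => ?_; ring
    _ = θ * (2 * (dSlotJConst M ε₀ κ nd * X) * ((dSlotIConst M ε₀ κ + 1) * X) * (Cs (κ + 2) * π + 1) ^ 4 +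
          4 * (Cs (κ + nd + 2) * π) * ((dSlotIConst M ε₀ κ + 1) * X) ^ 2 * (Cs (κ + 2) * π + 1) ^ 3) := by
        rw [sum_slot_erase_of_type (by positivity) (by have := hCs (κ + 2); positivity)]
    _ = tailConst M Cs ε₀ κ nd * X ^ 2 * θ := by unfold tailConst; ring

/-- **The kernel error level is bounded**: `ε_K ≤ A₃ c_P + (A₂ + |𝔖'|A₄) c_T (1+ε₀T'/(40π))^{-nd}
+ A₁ c_T X² (1+ε₀T/(40π))^{-nd}`. [cite: TaoTeravainen2021, §8 (8.19)–(8.25)] -/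
theorem kernelEps_le (hM : ∀ i, 0 ≤ M i) (hCs : ∀ n, 0 ≤ Cs n) (hX : 1 ≤ X) (hε₀ : 0 < ε₀) (hε₀20 : ε₀ ≤ 20)
    (hU₀lo : ε₀ / 20 * X ≤ U₀) (hU₀hi : U₀ ≤ X / 3) {T T' A₁ A₂ A₃ : ℝ} (hT : 0 ≤ T) (hT' : 0 ≤ T') (hA₁ : 0 ≤ A₁)
    (hA₂ : 0 ≤ A₂) (hA₃ : 0 ≤ A₃) (S' : ℝ) :
    kernelEps M Cs X U₀ κ nd T T' A₁ A₂ A₃ S' ≤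
      A₃ * prodIConst M Cs ε₀ κ + (A₂ + |S'| * modelA₄) * tailConst M Cs ε₀ κ nd * ((1 + ε₀ * T' / (40 * π)) ^ nd)⁻¹ +
        A₁ * tailConst M Cs ε₀ κ nd * X ^ 2 * ((1 + ε₀ * T / (40 * π)) ^ nd)⁻¹ := by
  have hX0 : 0 < X := by linarith
  have hX2 : 0 < X ^ 2 := by positivity
  have h1 := prod_slotI_le (M := M) (Cs := Cs) (κ := κ) hM hCs hX hε₀ hU₀lo hU₀hi
  have h2 := tailSum_le (M := M) (Cs := Cs) (κ := κ) (nd := nd) hM hCs hX hε₀ hε₀20 hU₀lo hU₀hi hT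
  have h3 := tailSum_le (M := M) (Cs := Cs) (κ := κ) (nd := nd) hM hCs hX hε₀ hε₀20 hU₀lo hU₀hi hT'
  have hSA : 0 ≤ A₂ + |S'| * modelA₄ := by have := modelA₄_nonneg; positivity
  unfold kernelEps
  rw [show A₃ * prodIConst M Cs ε₀ κ + (A₂ + |S'| * modelA₄) * tailConst M Cs ε₀ κ nd * ((1 + ε₀ * T' / (40 * π)) ^ nd)⁻¹ +
        A₁ * tailConst M Cs ε₀ κ nd * X ^ 2 * ((1 + ε₀ * T / (40 * π)) ^ nd)⁻¹ =
      (X ^ 2)⁻¹ * (A₃ * (prodIConst M Cs ε₀ κ * X ^ 2) +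
        (A₂ + |S'| * modelA₄) * (tailConst M Cs ε₀ κ nd * X ^ 2 * ((1 + ε₀ * T' / (40 * π)) ^ nd)⁻¹) +
        A₁ * X ^ 2 * (tailConst M Cs ε₀ κ nd * X ^ 2 * ((1 + ε₀ * T / (40 * π)) ^ nd)⁻¹)) by field_simp]
  refine mul_le_mul_of_nonneg_left ?_ (by positivity)
  gcongr

end KernelEps

/-! ### Sizes of the coefficient constants and of the triple sums -/

section Sizes

variable {q : ℕ}

/-- `C_c ≤ B₀ (6 + B_ψ) X²` for `X ≥ 1`, `U₀ ≤ X/3`, `B₀ ≥ 0`. [folklore] -/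
theorem sharpCoeffBound_le {B₀ Bψ X U₀ : ℝ} (hB₀ : 0 ≤ B₀) (hX : 1 ≤ X) (hU₀hi : U₀ ≤ X / 3) :
    sharpCoeffBound B₀ Bψ X U₀ ≤ B₀ * (6 + Bψ) * X ^ 2 := by
  unfold sharpCoeffBound
  have : 2 * (U₀ + 2) + (1 + Bψ) * X ^ 2 ≤ (6 + Bψ) * X ^ 2 := by nlinarith
  calc B₀ * (2 * (U₀ + 2) + (1 + Bψ) * X ^ 2) ≤ B₀ * ((6 + Bψ) * X ^ 2) := mul_le_mul_of_nonneg_left this hB₀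
    _ = _ := by ring

/-- `K_Ψ ≤ 9 B_ψ (B₀ + 17B₁) X²` for `X ≥ 1`. [folklore] -/
theorem psiAbelConst_le {B₀ B₁ Bψ X : ℝ} (hB₀ : 0 ≤ B₀) (hB₁ : 0 ≤ B₁) (hBψ : 0 ≤ Bψ) (hX : 1 ≤ X) :
    psiAbelConst B₀ B₁ Bψ X ≤ 9 * Bψ * (B₀ + 17 * B₁) * X ^ 2 := by
  unfold psiAbelConst
  have : (X + 2) ^ 2 ≤ 9 * X ^ 2 := by nlinarith
  calc Bψ * (X + 2) ^ 2 * (B₀ + 17 * B₁) = Bψ * (B₀ + 17 * B₁) * (X + 2) ^ 2 := by ring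
    _ ≤ Bψ * (B₀ + 17 * B₁) * (9 * X ^ 2) := mul_le_mul_of_nonneg_left this (by positivity)
    _ = _ := by ring

/-- **The triple sums**: `S(T_U) ≤ τ(q)⁴ (5 + 4 log x)^8` when `U ≤ x²`, `0 ≤ R ≤ x`, `x ≥ 1` (`q ≠ 0`).
[cite: TaoTeravainen2021, §8 ("`∑ τ(d)^{O(1)}/[…] ≪ log^{O(1)} x`")] -/
theorem tripleGcdSum_le_of_le (hq : q ≠ 0) {R : ℝ} (hR0 : 0 ≤ R) {x : ℕ} (hx : 1 ≤ x) (hRx : R ≤ x) {U : ℕ}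
    (hUx : U ≤ x ^ 2) :
    tripleGcdSum q (sharpTriples R U) ≤ ((#q.divisors : ℕ) : ℝ) ^ 4 * (5 + 4 * Real.log x) ^ 8 := by
  have hx0 : (0 : ℝ) < x := by exact_mod_cast hx
  have hx1 : (1 : ℝ) ≤ x := by exact_mod_cast hx
  refine (tripleGcdSum_sharpTriples_le hq R U).trans (mul_le_mul_of_nonneg_left ?_ (by positivity))
  have hlogx : 0 ≤ Real.log x := Real.log_nonneg hx1
  refine pow_le_pow_left₀ (by
    have : (1 : ℝ) ≤ ((U * ⌈R⌉₊ ^ 2 : ℕ) : ℝ) ∨ ((U * ⌈R⌉₊ ^ 2 : ℕ) : ℝ) < 1 := le_or_gt _ _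
    have h0 : 0 ≤ Real.log ((U * ⌈R⌉₊ ^ 2 : ℕ) : ℝ) ∨ Real.log ((U * ⌈R⌉₊ ^ 2 : ℕ) : ℝ) ≤ 0 := by
      rcases this with h | h
      · exact Or.inl (Real.log_nonneg h)
      · exact Or.inr (Real.log_nonpos (Nat.cast_nonneg _) h.le)
    rcases Nat.eq_zero_or_pos (U * ⌈R⌉₊ ^ 2) with hz | hz
    · rw [hz]; simp
    · have : (1 : ℝ) ≤ ((U * ⌈R⌉₊ ^ 2 : ℕ) : ℝ) := by exact_mod_cast hz
      have := Real.log_nonneg this; linarith) ?_ 8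
  -- `log(U ⌈R⌉²) ≤ log(x² (x+1)²) ≤ 4 log x + 4·?` : we use `⌈R⌉ ≤ x + 1 ≤ 2x`
  rcases Nat.eq_zero_or_pos (U * ⌈R⌉₊ ^ 2) with hz | hz
  · rw [hz]; simp; linarith
  have hceil : (⌈R⌉₊ : ℝ) ≤ 2 * x := by
    have := (Nat.ceil_lt_add_one hR0).le; linarith
  have hval : ((U * ⌈R⌉₊ ^ 2 : ℕ) : ℝ) ≤ (x : ℝ) ^ 2 * (2 * x) ^ 2 := by
    push_cast
    have hU' : (U : ℝ) ≤ (x : ℝ) ^ 2 := by exact_mod_cast hUx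
    have hc0 : (0 : ℝ) ≤ ⌈R⌉₊ := Nat.cast_nonneg _
    calc (U : ℝ) * (⌈R⌉₊ : ℝ) ^ 2 ≤ (x : ℝ) ^ 2 * (⌈R⌉₊ : ℝ) ^ 2 := by gcongr
      _ ≤ (x : ℝ) ^ 2 * (2 * x) ^ 2 := by gcongr
  have hpos : (0 : ℝ) < ((U * ⌈R⌉₊ ^ 2 : ℕ) : ℝ) := by exact_mod_cast hz
  calc 1 + Real.log ((U * ⌈R⌉₊ ^ 2 : ℕ) : ℝ) ≤ 1 + Real.log ((x : ℝ) ^ 2 * (2 * x) ^ 2) := by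
        gcongr
    _ = 1 + (4 * Real.log x + 2 * Real.log 2) := by
        rw [show (x : ℝ) ^ 2 * (2 * x) ^ 2 = 4 * (x : ℝ) ^ 4 by ring, Real.log_mul (by norm_num) (by positivity),
          Real.log_pow, show (4 : ℝ) = 2 ^ 2 by norm_num, Real.log_pow]; push_cast; ring
    _ ≤ 5 + 4 * Real.log x := by have := Real.log_two_lt_d9; nlinarith

/-- `(5 + 4 log x)^8 ≤ 9^8 (1 + log x)^8` (`x ≥ 1`). [folklore] -/
theorem five_add_four_log_pow_le {x : ℝ} (hx : 1 ≤ x) : (5 + 4 * Real.log x) ^ 8 ≤ 9 ^ 8 * (1 + Real.log x) ^ 8 := by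
  rw [← mul_pow]
  exact pow_le_pow_left₀ (by have := Real.log_nonneg hx; positivity) (by have := Real.log_nonneg hx; nlinarith) 8

/-- **`D_max ≤ 4e x^{ε₀/10} q⁴`** (`1 ≤ H ≤ x`, `q ≥ 1`, `ε₀ ≥ 0`). [cite: TaoTeravainen2021, §8] -/
theorem ppDmax_le {ε₀ : ℝ} (hε₀ : 0 ≤ ε₀) {q x H : ℕ} (hq : 1 ≤ q) (hx : 1 ≤ x) (hH : H ≤ x) :
    (ppDmax ε₀ q x H : ℝ) ≤ 4 * Real.exp 1 * (x : ℝ) ^ (ε₀ / 10) * (q : ℝ) ^ 4 := by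
  have hx0 : (0 : ℝ) < x := by exact_mod_cast hx
  have hq0 : (0 : ℝ) < q := by exact_mod_cast hq
  unfold ppDmax ppU
  set E := Real.exp (Real.log ((x + H : ℕ) : ℝ) - Real.log x + 2 * (ε₀ / 20 * Real.log x + 2 * Real.log q) + 1) with hE
  -- `E = ((x+H)/x) · x^{ε₀/10} · q⁴ · e ≤ 2 e x^{ε₀/10} q⁴`
  have hxH : (0 : ℝ) < ((x + H : ℕ) : ℝ) := by exact_mod_cast (show 0 < x + H by omega)
  have h1 : Real.exp (ε₀ / 10 * Real.log x) = (x : ℝ) ^ (ε₀ / 10) := by rw [Real.rpow_def_of_pos hx0, mul_comm]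
  have h2 : Real.exp (4 * Real.log q) = (q : ℝ) ^ 4 := by
    rw [show (4 : ℝ) * Real.log q = Real.log ((q : ℝ) ^ 4) by rw [Real.log_pow]; norm_num, Real.exp_log (by positivity)]
  have h3 : Real.exp (Real.log ((x + H : ℕ) : ℝ) - Real.log x) = ((x + H : ℕ) : ℝ) / x := by
    rw [Real.exp_sub, Real.exp_log hxH, Real.exp_log hx0]
  have hEval : E = ((x + H : ℕ) : ℝ) / x * ((x : ℝ) ^ (ε₀ / 10) * (q : ℝ) ^ 4) * Real.exp 1 := by
    rw [hE, show Real.log ((x + H : ℕ) : ℝ) - Real.log x + 2 * (ε₀ / 20 * Real.log x + 2 * Real.log q) + 1 =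
        (Real.log ((x + H : ℕ) : ℝ) - Real.log x) + (ε₀ / 10 * Real.log x) + (4 * Real.log q) + 1 by ring,
      Real.exp_add, Real.exp_add, Real.exp_add, h3, h1, h2]
    ring
  have hHx : (H : ℝ) ≤ x := by exact_mod_cast hH
  have hratio : ((x + H : ℕ) : ℝ) / x ≤ 2 := by
    rw [div_le_iff₀ hx0]; push_cast; linarith
  have hEle : E ≤ 2 * ((x : ℝ) ^ (ε₀ / 10) * (q : ℝ) ^ 4) * Real.exp 1 := by
    rw [hEval]; gcongr
  have hE1 : 1 ≤ E := by
    rw [hE]; refine Real.one_le_exp ?_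
    have h1 : Real.log x ≤ Real.log ((x + H : ℕ) : ℝ) := Real.log_le_log hx0 (by exact_mod_cast Nat.le_add_right x H)
    have h2 : 0 ≤ Real.log x := Real.log_nonneg (by exact_mod_cast hx)
    have h3 : 0 ≤ Real.log q := Real.log_nonneg (by exact_mod_cast hq)
    nlinarith
  calc (⌈E⌉₊ : ℝ) ≤ E + 1 := (Nat.ceil_lt_add_one (by linarith)).le
    _ ≤ 2 * E := by linarith
    _ ≤ 2 * (2 * ((x : ℝ) ^ (ε₀ / 10) * (q : ℝ) ^ 4) * Real.exp 1) := by linarith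
    _ = _ := by ring

/-- **`B_max ≤ e x^{ε₀/20} q²`** (`x, q ≥ 1`). [cite: TaoTeravainen2021, §7 (7.4)] -/
theorem ppBmax_le (ε₀ : ℝ) {q x : ℕ} (hq : 1 ≤ q) (hx : 1 ≤ x) :
    (ppBmax ε₀ q x : ℝ) ≤ Real.exp 1 * (x : ℝ) ^ (ε₀ / 20) * (q : ℝ) ^ 2 := by
  have hx0 : (0 : ℝ) < x := by exact_mod_cast hx
  have hq0 : (0 : ℝ) < q := by exact_mod_cast hq
  unfold ppBmax ppU
  have hval : Real.exp (ε₀ / 20 * Real.log x + 2 * Real.log q + 1) = (x : ℝ) ^ (ε₀ / 20) * (q : ℝ) ^ 2 * Real.exp 1 := by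
    rw [Real.exp_add, Real.exp_add, mul_comm (ε₀ / 20) (Real.log x), ← Real.rpow_def_of_pos hx0,
      show 2 * Real.log q = Real.log ((q : ℝ) ^ 2) by rw [Real.log_pow]; push_cast; ring, Real.exp_log (by positivity)]
  calc (⌊Real.exp (ε₀ / 20 * Real.log x + 2 * Real.log q + 1)⌋₊ : ℝ) ≤ Real.exp (ε₀ / 20 * Real.log x + 2 * Real.log q + 1) :=
        Nat.floor_le (Real.exp_pos _).le
    _ = _ := by rw [hval]; ring

end Sizes

/-! ### The three aggregate error terms -/

section Aggregate

/-- **The `χ`-twisted error, monotone form**: with `C_c ≤ c_C`, `K_Ψ ≤ c_K`, `K_b, K_l, K_r ≤ K`,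
`S_B, S_D ≤ S`, `#T_B, #T_D ≤ N` (all nonnegative),
`E_χ ≤ (c_C² + 2 c_C c_K) B_ψ⁴ K (x/q · S² + √q · N²)`. [cite: TaoTeravainen2021, §8 (disposal of `g_{d,d'}`)] -/
theorem typeI_error_le {Cc KΨ Kb Kl Kr SB SD NB ND xq sq Bψ cC cK K S N : ℝ}
    (hCc0 : 0 ≤ Cc) (hKΨ0 : 0 ≤ KΨ) (hKb0 : 0 ≤ Kb) (hKl0 : 0 ≤ Kl) (hKr0 : 0 ≤ Kr) (hSB0 : 0 ≤ SB) (hSD0 : 0 ≤ SD)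
    (hNB0 : 0 ≤ NB) (hND0 : 0 ≤ ND) (hxq : 0 ≤ xq) (hsq : 0 ≤ sq)
    (hCc : Cc ≤ cC) (hKΨ : KΨ ≤ cK) (hKb : Kb ≤ K) (hKl : Kl ≤ K) (hKr : Kr ≤ K) (hSB : SB ≤ S) (hSD : SD ≤ S)
    (hNB : NB ≤ N) (hND : ND ≤ N) :
    (Cc * Bψ ^ 2) * (Cc * Bψ ^ 2) * Kb * (xq * SB * SB + sq * NB * NB) +
        (Cc * Bψ ^ 2) * (Bψ ^ 2) * (KΨ * Kl) * (xq * SB * SD + sq * NB * ND) +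
        (Bψ ^ 2) * (Cc * Bψ ^ 2) * (KΨ * Kr) * (xq * SD * SB + sq * ND * NB) ≤
      (cC ^ 2 + 2 * cC * cK) * Bψ ^ 4 * K * (xq * S ^ 2 + sq * N ^ 2) := by
  have hcC0 : 0 ≤ cC := hCc0.trans hCc
  have hcK0 : 0 ≤ cK := hKΨ0.trans hKΨ
  have hK0 : 0 ≤ K := hKb0.trans hKb
  have hS0 : 0 ≤ S := hSB0.trans hSB
  have hN0 : 0 ≤ N := hNB0.trans hNB
  have hB2 : 0 ≤ Bψ ^ 2 := sq_nonneg _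
  have hP : ∀ {a b : ℝ}, 0 ≤ a → 0 ≤ b → a ≤ S → b ≤ S → ∀ {m n : ℝ}, 0 ≤ m → 0 ≤ n → m ≤ N → n ≤ N →
      xq * a * b + sq * m * n ≤ xq * S ^ 2 + sq * N ^ 2 := by
    intro a b ha hb haS hbS m n hm hn hmN hnN
    have h1 : a * b ≤ S ^ 2 := by nlinarith
    have h2 : m * n ≤ N ^ 2 := by nlinarith
    nlinarith [mul_le_mul_of_nonneg_left h1 hxq, mul_le_mul_of_nonneg_left h2 hsq]
  have hQ0 : 0 ≤ xq * S ^ 2 + sq * N ^ 2 := by positivity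
  have t1 : (Cc * Bψ ^ 2) * (Cc * Bψ ^ 2) * Kb * (xq * SB * SB + sq * NB * NB) ≤
      (cC * Bψ ^ 2) * (cC * Bψ ^ 2) * K * (xq * S ^ 2 + sq * N ^ 2) :=
    mul_le_mul (mul_le_mul (mul_le_mul (by gcongr) (by gcongr) (by positivity) (by positivity)) hKb hKb0 (by positivity))
      (hP hSB0 hSB0 hSB hSB hNB0 hNB0 hNB hNB) (by positivity) (by positivity)
  have t2 : (Cc * Bψ ^ 2) * (Bψ ^ 2) * (KΨ * Kl) * (xq * SB * SD + sq * NB * ND) ≤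
      (cC * Bψ ^ 2) * (Bψ ^ 2) * (cK * K) * (xq * S ^ 2 + sq * N ^ 2) :=
    mul_le_mul (mul_le_mul (by gcongr) (mul_le_mul hKΨ hKl hKl0 hcK0) (by positivity) (by positivity))
      (hP hSB0 hSD0 hSB hSD hNB0 hND0 hNB hND) (by positivity) (by positivity)
  have t3 : (Bψ ^ 2) * (Cc * Bψ ^ 2) * (KΨ * Kr) * (xq * SD * SB + sq * ND * NB) ≤
      (Bψ ^ 2) * (cC * Bψ ^ 2) * (cK * K) * (xq * S ^ 2 + sq * N ^ 2) :=
    mul_le_mul (mul_le_mul (by gcongr) (mul_le_mul hKΨ hKr hKr0 hcK0) (by positivity) (by positivity))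
      (hP hSD0 hSB0 hSD hSB hND0 hNB0 hND hNB) (by positivity) (by positivity)
  calc _ ≤ (cC * Bψ ^ 2) * (cC * Bψ ^ 2) * K * (xq * S ^ 2 + sq * N ^ 2) +
        (cC * Bψ ^ 2) * (Bψ ^ 2) * (cK * K) * (xq * S ^ 2 + sq * N ^ 2) +
        (Bψ ^ 2) * (cC * Bψ ^ 2) * (cK * K) * (xq * S ^ 2 + sq * N ^ 2) := add_le_add (add_le_add t1 t2) t3
    _ = _ := by ring

/-- **The crude constant**: `M_crude = B_ψ⁴ |Δ| (2 B_ψ B₀ (L+1))² S₁² ≤ B_ψ⁶ |Δ| 4 B₀² (L+1)² S₁_max²`, monotone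
in `S₁ ≤ S₁max` (nonnegative data). [folklore] -/
theorem crude_const_le {Bψ B₀ L S1 S1max Δ : ℝ} (hΔ : 0 ≤ Δ) (hS1 : 0 ≤ S1) (hS : S1 ≤ S1max) :
    Bψ ^ 4 * Δ * (2 * Bψ * B₀ * (L + 1)) ^ 2 * S1 ^ 2 ≤ Bψ ^ 4 * Δ * (2 * Bψ * B₀ * (L + 1)) ^ 2 * S1max ^ 2 := by
  gcongr

end Aggregate

/-! ### Nonnegativity of the constants -/

/-- `0 ≤ C_ε`. [folklore] -/
theorem moebiusErrConst_nonneg {M : ℕ → ℝ} (hM : ∀ i, 0 ≤ M i) {C₀ ε₀ : ℝ} (hC₀ : 0 ≤ C₀) (hε₀ : 0 < ε₀) :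
    0 ≤ moebiusErrConst M C₀ ε₀ := by
  unfold moebiusErrConst
  have : 0 ≤ cutoffDerivSum M 0 := sum_nonneg fun i _ => hM i
  have : 0 ≤ cutoffDerivSum M 30 := sum_nonneg fun i _ => hM i
  positivity

/-- `0 ≤ b_I`. [folklore] -/
theorem dSlotIConst_nonneg {M : ℕ → ℝ} (hM : ∀ i, 0 ≤ M i) {ε₀ : ℝ} (hε₀ : 0 < ε₀) (κ : ℕ) :
    0 ≤ dSlotIConst M ε₀ κ := by
  unfold dSlotIConst
  have : 0 ≤ cutoffDerivSum M (κ + 2) := sum_nonneg fun i _ => hM i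
  positivity

/-- `0 ≤ b_J`. [folklore] -/
theorem dSlotJConst_nonneg {M : ℕ → ℝ} (hM : ∀ i, 0 ≤ M i) {ε₀ : ℝ} (hε₀ : 0 < ε₀) (κ nd : ℕ) :
    0 ≤ dSlotJConst M ε₀ κ nd := by
  unfold dSlotJConst
  have : 0 ≤ cutoffDerivSum M (κ + nd + 2) := sum_nonneg fun i _ => hM i
  positivity

/-- `0 ≤ c_P`. [folklore] -/
theorem prodIConst_nonneg (M Cs : ℕ → ℝ) (ε₀ : ℝ) (κ : ℕ) : 0 ≤ prodIConst M Cs ε₀ κ := by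
  unfold prodIConst; positivity

/-- `0 ≤ c_T`. [folklore] -/
theorem tailConst_nonneg {M Cs : ℕ → ℝ} (hM : ∀ i, 0 ≤ M i) (hCs : ∀ n, 0 ≤ Cs n) {ε₀ : ℝ} (hε₀ : 0 < ε₀) (κ nd : ℕ) :
    0 ≤ tailConst M Cs ε₀ κ nd := by
  unfold tailConst
  have h1 := dSlotIConst_nonneg hM hε₀ κ
  have h2 := dSlotJConst_nonneg hM hε₀ κ nd
  have h3 := hCs (κ + 2)
  have h4 := hCs (κ + nd + 2)
  positivity

end TaoTeravainen

end Literature.Barriers.Parity
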